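import Mathlib
import HarnessLib
import Summits.NavierStokesRegularity.NavierStokesRegularity.Theorems.SymmetryModuliCountForcedSymmetryStubSatelliteExclusionTools
import Summits.NavierStokesRegularity.NavierStokesRegularity.Theorems.SymmetryModuliCountForcedSymmetryStubDecayOfSatelliteFree
import Summits.NavierStokesRegularity.NavierStokesRegularity.Theorems.SymmetryModuliCountForcedSymmetryRecurrentClosingWeakest

/-!
# Crux `ForcedSymmetry` (stmt-NavierStokesRegularity-4052), line `recurrent-closing`, skeleton gen 5: NO SLACK —
# `ForcedSymmetry ↔ (satellite exclusion ∧ centred wall ∧ RDSS-sufficiency)`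

Route `SymmetryModuliCount`, sub-problem `NavierStokesRegularity`.  Lead seat c8 (2026-08-17), skeleton gen 5.2
(`Cruxes/ForcedSymmetry/Lines/recurrent_closing.lean`, three `sorry`s: `stub_recurrentClosingWeak`,
`stub_satelliteExclusion`, `stub_centredWall`).

This file is the kernel-checked certificate that the registered gen-5 skeleton has NO SLACK: each of its three open stubs
is implied by the crux, and together they imply it.  With the statements of crux stmt-NavierStokesRegularity-8561's birth
stubs 1 and 3 written out VERBATIM (`stub_satelliteExclusion` = "3a", `stub_centredWall` = "3c") and RDSS-sufficiency
`RDSSLiouvilleInClass → TypeIAncientLiouville` (the recurrence-free form of `stub_recurrentClosingWeak`,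
`recurrentClosingWeak_iff_rdssLiouville_imp`, p140852):

* `rdssLiouvilleInClass_of_birthStubs` — 3a → 3c → `RDSSLiouvilleInClass` (the birth composition of crux 8561's line
  `birth`, importable form: τ-reduction `rdssLiouvilleInClass_iff_centreTimeZero` + the landed decay step
  `stub_decayOfSatelliteFree`);
* `centredWall_of_typeIAncientLiouville` — `X` → 3c (vacuous: under `X` no profile of the class is singular);
* `typeIAncientLiouville_iff_birthStubs_and_rdssSufficiency` — `X ↔ (3a ∧ 3c ∧ (RDSSLiouvilleInClass → X))`;
* `forcedSymmetry_iff_birthStubs_and_rdssSufficiency` — the same with the crux on the left (collapse p109874);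
* `forcedSymmetry_iff_recurrentClosingWeak_of_birthStubs` — given 3a and 3c, the crux is EXACTLY the closing stub.

Consequence for the line: the three sorries of gen 5.2 are three open statements none of which can be weakened inside
this composition (each is necessary), and closing any two of them leaves a residual equivalent to the crux minus nothing.

References: Albritton–Barker, Ann. PDE 5 (2019) [AlbrittonBarker2019, §1, §3]; Chae–Wolf, Comm. PDE 42 (2017)
[ChaeWolf2017RemovingDSS, Thm 1.1]; Bradshaw–Tsai, Comm. PDE 42 (2017) [BradshawTsai2017CPDE, OP 5.1].
-/

noncomputable section

-- the summit and its single problem share the name (D-0017 nested layout)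
set_option linter.dupNamespace false

open MeasureTheory Set Function
open Literature.Analysis.FluidPDE
open Summit.NavierStokesRegularity.NavierStokesRegularity.Theses
open Summit.NavierStokesRegularity.NavierStokesRegularity.Theses.SymmetryModuliCount
open Summit.NavierStokesRegularity.NavierStokesRegularity.Theses.DulacContraction

namespace Summit.NavierStokesRegularity.NavierStokesRegularity.Theorems.SymmetryModuliCountForcedSymmetry

/-! ### The birth composition, importable: 3a → 3c → stmt-8561 -/

/-- **Birth composition of crux stmt-8561 (importable form).**  If every smooth RDSS profile of Albritton–Barker's class
centred on the final slice has no singular satellite (3a, `stub_satelliteExclusion` verbatim) and every such profile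
centred at the origin with space–time Type-I decay is regular at the origin (3c, `stub_centredWall` verbatim), then
`RDSSLiouvilleInClass` holds: reduce to `τ = 0` (`rdssLiouvilleInClass_iff_centreTimeZero`); if the spatial centre is
not the origin, the origin is a satellite point (3a); otherwise 3a clears `y ≠ 0`, the landed decay step
`stub_decayOfSatelliteFree` gives `HasTypeIDecay`, and 3c removes the centre.
[cite: AlbrittonBarker2019, §1; ChaeWolf2017RemovingDSS, Thm 1.1] -/
theorem rdssLiouvilleInClass_of_birthStubs
    (h3a : ∀ (w : ℝ → (EuclideanSpace ℝ (Fin 3)) → (EuclideanSpace ℝ (Fin 3))) (q : ℝ → (EuclideanSpace ℝ (Fin 3)) → ℝ) (H : ℝ → (EuclideanSpace ℝ (Fin 3)) → (EuclideanSpace ℝ (Fin 3)) →L[ℝ] (EuclideanSpace ℝ (Fin 3))) (C : ℝ),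
      IsSuitableWeakSolutionOn (slab (EuclideanSpace ℝ (Fin 3)) (Set.Iio 0) isOpen_Iio) 1 0 w q →
      HasWeakSpatialGradientOn (slab (EuclideanSpace ℝ (Fin 3)) (Set.Iio 0) isOpen_Iio) w H →
      typeIBound (Set.Iio (0 : ℝ) ×ˢ Set.univ) w q H < ⊤ →
      HasTypeITimeDecay C w →
      IsClassicalNSSolutionOn (Set.Iio 0) 1 0 w q →
      ∀ (l : ℝ) (R : (EuclideanSpace ℝ (Fin 3)) ≃ₗᵢ[ℝ] (EuclideanSpace ℝ (Fin 3))) (ξ : (EuclideanSpace ℝ (Fin 3))), 1 < l →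
        (fun z : ℝ × (EuclideanSpace ℝ (Fin 3)) => l • R.symm (w (l ^ 2 * z.1) (l • R z.2 + ξ)))
          =ᵐ[volume.restrict (Set.Iio (0 : ℝ) ×ˢ Set.univ)] (fun z : ℝ × (EuclideanSpace ℝ (Fin 3)) => w z.1 z.2) →
        ∀ y : (EuclideanSpace ℝ (Fin 3)), y ≠ l • R y + ξ → ¬ IsBackwardSingularPoint w ((0 : ℝ), y))
    (h3c : ∀ (w : ℝ → (EuclideanSpace ℝ (Fin 3)) → (EuclideanSpace ℝ (Fin 3))) (q : ℝ → (EuclideanSpace ℝ (Fin 3)) → ℝ) (H : ℝ → (EuclideanSpace ℝ (Fin 3)) → (EuclideanSpace ℝ (Fin 3)) →L[ℝ] (EuclideanSpace ℝ (Fin 3))) (C : ℝ),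
      IsSuitableWeakSolutionOn (slab (EuclideanSpace ℝ (Fin 3)) (Set.Iio 0) isOpen_Iio) 1 0 w q →
      HasWeakSpatialGradientOn (slab (EuclideanSpace ℝ (Fin 3)) (Set.Iio 0) isOpen_Iio) w H →
      typeIBound (Set.Iio (0 : ℝ) ×ˢ Set.univ) w q H < ⊤ →
      HasTypeITimeDecay C w →
      IsClassicalNSSolutionOn (Set.Iio 0) 1 0 w q →
      ∀ (l : ℝ) (R : (EuclideanSpace ℝ (Fin 3)) ≃ₗᵢ[ℝ] (EuclideanSpace ℝ (Fin 3))), 1 < l →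
        (fun z : ℝ × (EuclideanSpace ℝ (Fin 3)) => l • R.symm (w (l ^ 2 * z.1) (l • R z.2)))
          =ᵐ[volume.restrict (Set.Iio (0 : ℝ) ×ˢ Set.univ)] (fun z : ℝ × (EuclideanSpace ℝ (Fin 3)) => w z.1 z.2) →
        (∃ C₀ : ℝ, HasTypeIDecay C₀ w) →
        ¬ IsBackwardSingularPoint w 0) :
    RDSSLiouvilleInClass := by
  rw [rdssLiouvilleInClass_iff_centreTimeZero]
  intro w q H C hsw hwg hI hdec hcl hinv
  obtain ⟨l, hl, R, ξ, hae⟩ := hinv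
  by_cases hξ : ξ = 0
  · -- centre AT the origin: satellites (3a), decay (3b, landed), wall (3c)
    subst hξ
    have hae0 : (fun z : ℝ × (EuclideanSpace ℝ (Fin 3)) => l • R.symm (w (l ^ 2 * z.1) (l • R z.2)))
        =ᵐ[volume.restrict (Set.Iio (0 : ℝ) ×ˢ Set.univ)] (fun z : ℝ × (EuclideanSpace ℝ (Fin 3)) => w z.1 z.2) := by
      simpa only [add_zero] using hae
    have hoff : ∀ y : (EuclideanSpace ℝ (Fin 3)), y ≠ l • R y → ¬ IsBackwardSingularPoint w ((0 : ℝ), y) := by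
      intro y hy
      exact h3a w q H C hsw hwg hI hdec hcl l R 0 hl hae y (by simpa only [add_zero] using hy)
    obtain ⟨C₀, hC₀⟩ := stub_decayOfSatelliteFree w q C hdec hcl l R hl hae0 hoff
    exact h3c w q H C hsw hwg hI hdec hcl l R hl hae0 ⟨C₀, hC₀⟩
  · -- centre `x* ≠ 0` on the final slice: the origin is a satellite point, regular by 3a
    have h0 : (0 : (EuclideanSpace ℝ (Fin 3))) ≠ l • R 0 + ξ := by
      intro h
      apply hξ
      have hz : l • R (0 : (EuclideanSpace ℝ (Fin 3))) + ξ = ξ := by simp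
      rw [hz] at h
      exact h.symm
    exact h3a w q H C hsw hwg hI hdec hcl l R ξ hl hae 0 h0

/-! ### Each birth stub is at most `X` -/

/-- **`X ⇒ stub_centredWall`** (vacuously): under the route target no profile of Albritton–Barker's class is singular at
the origin (`noTypeIRateProfile_of_typeIAncientLiouville`), in particular no RDSS one with decay — verbatim the registered
signature of `stub_centredWall`, behind the hypothesis `X`. [cite: AlbrittonBarker2019, Thm 1.1, §3] -/
theorem centredWall_of_typeIAncientLiouville (hX : TypeIAncientLiouville) :
    ∀ (w : ℝ → (EuclideanSpace ℝ (Fin 3)) → (EuclideanSpace ℝ (Fin 3))) (q : ℝ → (EuclideanSpace ℝ (Fin 3)) → ℝ) (H : ℝ → (EuclideanSpace ℝ (Fin 3)) → (EuclideanSpace ℝ (Fin 3)) →L[ℝ] (EuclideanSpace ℝ (Fin 3))) (C : ℝ),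
      IsSuitableWeakSolutionOn (slab (EuclideanSpace ℝ (Fin 3)) (Set.Iio 0) isOpen_Iio) 1 0 w q →
      HasWeakSpatialGradientOn (slab (EuclideanSpace ℝ (Fin 3)) (Set.Iio 0) isOpen_Iio) w H →
      typeIBound (Set.Iio (0 : ℝ) ×ˢ Set.univ) w q H < ⊤ →
      HasTypeITimeDecay C w →
      IsClassicalNSSolutionOn (Set.Iio 0) 1 0 w q →
      ∀ (l : ℝ) (R : (EuclideanSpace ℝ (Fin 3)) ≃ₗᵢ[ℝ] (EuclideanSpace ℝ (Fin 3))), 1 < l →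
        (fun z : ℝ × (EuclideanSpace ℝ (Fin 3)) => l • R.symm (w (l ^ 2 * z.1) (l • R z.2)))
          =ᵐ[volume.restrict (Set.Iio (0 : ℝ) ×ˢ Set.univ)] (fun z : ℝ × (EuclideanSpace ℝ (Fin 3)) => w z.1 z.2) →
        (∃ C₀ : ℝ, HasTypeIDecay C₀ w) →
        ¬ IsBackwardSingularPoint w 0 := by
  intro w q H C hsw hwg hI hdec _hcl _l _R _hl _hinv _hC₀
  exact noTypeIRateProfile_of_typeIAncientLiouville hX w q H C hsw hwg hI hdec

/-! ### NO SLACK for skeleton gen 5 -/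

/-- **NO SLACK (gen 5): `X ↔ (3a ∧ 3c ∧ (RDSSLiouvilleInClass → X))`.**  The route target is exactly the conjunction of
the statements behind the three `sorry`s of the registered skeleton gen 5.2 of line `recurrent-closing` — satellite
exclusion (3a), the centred wall (3c), and RDSS-sufficiency (the recurrence-free form of `stub_recurrentClosingWeak`,
p140852): `→` by `satelliteExclusion_of_typeIAncientLiouville`, `centredWall_of_typeIAncientLiouville` and logic;
`←` by the birth composition `rdssLiouvilleInClass_of_birthStubs` and modus ponens.
[cite: AlbrittonBarker2019, Thm 1.1, §3; ChaeWolf2017RemovingDSS, Thm 1.1; BradshawTsai2017CPDE, OP 5.1] -/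
theorem typeIAncientLiouville_iff_birthStubs_and_rdssSufficiency :
    TypeIAncientLiouville ↔
      ((∀ (w : ℝ → (EuclideanSpace ℝ (Fin 3)) → (EuclideanSpace ℝ (Fin 3))) (q : ℝ → (EuclideanSpace ℝ (Fin 3)) → ℝ) (H : ℝ → (EuclideanSpace ℝ (Fin 3)) → (EuclideanSpace ℝ (Fin 3)) →L[ℝ] (EuclideanSpace ℝ (Fin 3))) (C : ℝ),
          IsSuitableWeakSolutionOn (slab (EuclideanSpace ℝ (Fin 3)) (Set.Iio 0) isOpen_Iio) 1 0 w q →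
          HasWeakSpatialGradientOn (slab (EuclideanSpace ℝ (Fin 3)) (Set.Iio 0) isOpen_Iio) w H →
          typeIBound (Set.Iio (0 : ℝ) ×ˢ Set.univ) w q H < ⊤ →
          HasTypeITimeDecay C w →
          IsClassicalNSSolutionOn (Set.Iio 0) 1 0 w q →
          ∀ (l : ℝ) (R : (EuclideanSpace ℝ (Fin 3)) ≃ₗᵢ[ℝ] (EuclideanSpace ℝ (Fin 3))) (ξ : (EuclideanSpace ℝ (Fin 3))), 1 < l →
            (fun z : ℝ × (EuclideanSpace ℝ (Fin 3)) => l • R.symm (w (l ^ 2 * z.1) (l • R z.2 + ξ)))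
              =ᵐ[volume.restrict (Set.Iio (0 : ℝ) ×ˢ Set.univ)] (fun z : ℝ × (EuclideanSpace ℝ (Fin 3)) => w z.1 z.2) →
            ∀ y : (EuclideanSpace ℝ (Fin 3)), y ≠ l • R y + ξ → ¬ IsBackwardSingularPoint w ((0 : ℝ), y)) ∧
        (∀ (w : ℝ → (EuclideanSpace ℝ (Fin 3)) → (EuclideanSpace ℝ (Fin 3))) (q : ℝ → (EuclideanSpace ℝ (Fin 3)) → ℝ) (H : ℝ → (EuclideanSpace ℝ (Fin 3)) → (EuclideanSpace ℝ (Fin 3)) →L[ℝ] (EuclideanSpace ℝ (Fin 3))) (C : ℝ),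
          IsSuitableWeakSolutionOn (slab (EuclideanSpace ℝ (Fin 3)) (Set.Iio 0) isOpen_Iio) 1 0 w q →
          HasWeakSpatialGradientOn (slab (EuclideanSpace ℝ (Fin 3)) (Set.Iio 0) isOpen_Iio) w H →
          typeIBound (Set.Iio (0 : ℝ) ×ˢ Set.univ) w q H < ⊤ →
          HasTypeITimeDecay C w →
          IsClassicalNSSolutionOn (Set.Iio 0) 1 0 w q →
          ∀ (l : ℝ) (R : (EuclideanSpace ℝ (Fin 3)) ≃ₗᵢ[ℝ] (EuclideanSpace ℝ (Fin 3))), 1 < l →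
            (fun z : ℝ × (EuclideanSpace ℝ (Fin 3)) => l • R.symm (w (l ^ 2 * z.1) (l • R z.2)))
              =ᵐ[volume.restrict (Set.Iio (0 : ℝ) ×ˢ Set.univ)] (fun z : ℝ × (EuclideanSpace ℝ (Fin 3)) => w z.1 z.2) →
            (∃ C₀ : ℝ, HasTypeIDecay C₀ w) →
            ¬ IsBackwardSingularPoint w 0) ∧
        (RDSSLiouvilleInClass → TypeIAncientLiouville)) := by
  constructor
  · intro hX
    exact ⟨satelliteExclusion_of_typeIAncientLiouville hX, centredWall_of_typeIAncientLiouville hX, fun _ => hX⟩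
  · rintro ⟨h3a, h3c, hsuff⟩
    exact hsuff (rdssLiouvilleInClass_of_birthStubs h3a h3c)

/-- **NO SLACK (gen 5) at the crux: `ForcedSymmetry ↔ (3a ∧ 3c ∧ (RDSSLiouvilleInClass → X))`** — the registered
skeleton's three sorries, written out, are jointly equivalent to the crux and each is implied by it
(`forcedSymmetry_iff_typeIAncientLiouville`, p109874, composed with
`typeIAncientLiouville_iff_birthStubs_and_rdssSufficiency`). [cite: AlbrittonBarker2019, Thm 1.1, §3; BradshawTsai2017CPDE, OP 5.1] -/
theorem forcedSymmetry_iff_birthStubs_and_rdssSufficiency :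
    ForcedSymmetry ↔
      ((∀ (w : ℝ → (EuclideanSpace ℝ (Fin 3)) → (EuclideanSpace ℝ (Fin 3))) (q : ℝ → (EuclideanSpace ℝ (Fin 3)) → ℝ) (H : ℝ → (EuclideanSpace ℝ (Fin 3)) → (EuclideanSpace ℝ (Fin 3)) →L[ℝ] (EuclideanSpace ℝ (Fin 3))) (C : ℝ),
          IsSuitableWeakSolutionOn (slab (EuclideanSpace ℝ (Fin 3)) (Set.Iio 0) isOpen_Iio) 1 0 w q →
          HasWeakSpatialGradientOn (slab (EuclideanSpace ℝ (Fin 3)) (Set.Iio 0) isOpen_Iio) w H →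
          typeIBound (Set.Iio (0 : ℝ) ×ˢ Set.univ) w q H < ⊤ →
          HasTypeITimeDecay C w →
          IsClassicalNSSolutionOn (Set.Iio 0) 1 0 w q →
          ∀ (l : ℝ) (R : (EuclideanSpace ℝ (Fin 3)) ≃ₗᵢ[ℝ] (EuclideanSpace ℝ (Fin 3))) (ξ : (EuclideanSpace ℝ (Fin 3))), 1 < l →
            (fun z : ℝ × (EuclideanSpace ℝ (Fin 3)) => l • R.symm (w (l ^ 2 * z.1) (l • R z.2 + ξ)))
              =ᵐ[volume.restrict (Set.Iio (0 : ℝ) ×ˢ Set.univ)] (fun z : ℝ × (EuclideanSpace ℝ (Fin 3)) => w z.1 z.2) →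
            ∀ y : (EuclideanSpace ℝ (Fin 3)), y ≠ l • R y + ξ → ¬ IsBackwardSingularPoint w ((0 : ℝ), y)) ∧
        (∀ (w : ℝ → (EuclideanSpace ℝ (Fin 3)) → (EuclideanSpace ℝ (Fin 3))) (q : ℝ → (EuclideanSpace ℝ (Fin 3)) → ℝ) (H : ℝ → (EuclideanSpace ℝ (Fin 3)) → (EuclideanSpace ℝ (Fin 3)) →L[ℝ] (EuclideanSpace ℝ (Fin 3))) (C : ℝ),
          IsSuitableWeakSolutionOn (slab (EuclideanSpace ℝ (Fin 3)) (Set.Iio 0) isOpen_Iio) 1 0 w q →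
          HasWeakSpatialGradientOn (slab (EuclideanSpace ℝ (Fin 3)) (Set.Iio 0) isOpen_Iio) w H →
          typeIBound (Set.Iio (0 : ℝ) ×ˢ Set.univ) w q H < ⊤ →
          HasTypeITimeDecay C w →
          IsClassicalNSSolutionOn (Set.Iio 0) 1 0 w q →
          ∀ (l : ℝ) (R : (EuclideanSpace ℝ (Fin 3)) ≃ₗᵢ[ℝ] (EuclideanSpace ℝ (Fin 3))), 1 < l →
            (fun z : ℝ × (EuclideanSpace ℝ (Fin 3)) => l • R.symm (w (l ^ 2 * z.1) (l • R z.2)))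
              =ᵐ[volume.restrict (Set.Iio (0 : ℝ) ×ˢ Set.univ)] (fun z : ℝ × (EuclideanSpace ℝ (Fin 3)) => w z.1 z.2) →
            (∃ C₀ : ℝ, HasTypeIDecay C₀ w) →
            ¬ IsBackwardSingularPoint w 0) ∧
        (RDSSLiouvilleInClass → TypeIAncientLiouville)) :=
  forcedSymmetry_iff_typeIAncientLiouville.trans typeIAncientLiouville_iff_birthStubs_and_rdssSufficiency

/-- **Given the two birth stubs, the crux IS the closing stub.**  If 3a and 3c hold (so that stmt-8561 holds, by
`rdssLiouvilleInClass_of_birthStubs`), then `ForcedSymmetry` is equivalent to the registered closing stub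
`stub_recurrentClosingWeak` (written out): both are then equivalent to `X`
(`recurrentClosingWeak_iff_rdssLiouville_imp`, p140852, and the collapse p109874).  This is the exact sense in which
the line "dies by the standard of the earlier lines" the moment crux 8561 is proved.
[cite: AlbrittonBarker2019, Thm 1.1, §3; BradshawTsai2017CPDE, OP 5.1] -/
theorem forcedSymmetry_iff_recurrentClosingWeak_of_birthStubs
    (h3a : ∀ (w : ℝ → (EuclideanSpace ℝ (Fin 3)) → (EuclideanSpace ℝ (Fin 3))) (q : ℝ → (EuclideanSpace ℝ (Fin 3)) → ℝ) (H : ℝ → (EuclideanSpace ℝ (Fin 3)) → (EuclideanSpace ℝ (Fin 3)) →L[ℝ] (EuclideanSpace ℝ (Fin 3))) (C : ℝ),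
      IsSuitableWeakSolutionOn (slab (EuclideanSpace ℝ (Fin 3)) (Set.Iio 0) isOpen_Iio) 1 0 w q →
      HasWeakSpatialGradientOn (slab (EuclideanSpace ℝ (Fin 3)) (Set.Iio 0) isOpen_Iio) w H →
      typeIBound (Set.Iio (0 : ℝ) ×ˢ Set.univ) w q H < ⊤ →
      HasTypeITimeDecay C w →
      IsClassicalNSSolutionOn (Set.Iio 0) 1 0 w q →
      ∀ (l : ℝ) (R : (EuclideanSpace ℝ (Fin 3)) ≃ₗᵢ[ℝ] (EuclideanSpace ℝ (Fin 3))) (ξ : (EuclideanSpace ℝ (Fin 3))), 1 < l →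
        (fun z : ℝ × (EuclideanSpace ℝ (Fin 3)) => l • R.symm (w (l ^ 2 * z.1) (l • R z.2 + ξ)))
          =ᵐ[volume.restrict (Set.Iio (0 : ℝ) ×ˢ Set.univ)] (fun z : ℝ × (EuclideanSpace ℝ (Fin 3)) => w z.1 z.2) →
        ∀ y : (EuclideanSpace ℝ (Fin 3)), y ≠ l • R y + ξ → ¬ IsBackwardSingularPoint w ((0 : ℝ), y))
    (h3c : ∀ (w : ℝ → (EuclideanSpace ℝ (Fin 3)) → (EuclideanSpace ℝ (Fin 3))) (q : ℝ → (EuclideanSpace ℝ (Fin 3)) → ℝ) (H : ℝ → (EuclideanSpace ℝ (Fin 3)) → (EuclideanSpace ℝ (Fin 3)) →L[ℝ] (EuclideanSpace ℝ (Fin 3))) (C : ℝ),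
      IsSuitableWeakSolutionOn (slab (EuclideanSpace ℝ (Fin 3)) (Set.Iio 0) isOpen_Iio) 1 0 w q →
      HasWeakSpatialGradientOn (slab (EuclideanSpace ℝ (Fin 3)) (Set.Iio 0) isOpen_Iio) w H →
      typeIBound (Set.Iio (0 : ℝ) ×ˢ Set.univ) w q H < ⊤ →
      HasTypeITimeDecay C w →
      IsClassicalNSSolutionOn (Set.Iio 0) 1 0 w q →
      ∀ (l : ℝ) (R : (EuclideanSpace ℝ (Fin 3)) ≃ₗᵢ[ℝ] (EuclideanSpace ℝ (Fin 3))), 1 < l →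
        (fun z : ℝ × (EuclideanSpace ℝ (Fin 3)) => l • R.symm (w (l ^ 2 * z.1) (l • R z.2)))
          =ᵐ[volume.restrict (Set.Iio (0 : ℝ) ×ˢ Set.univ)] (fun z : ℝ × (EuclideanSpace ℝ (Fin 3)) => w z.1 z.2) →
        (∃ C₀ : ℝ, HasTypeIDecay C₀ w) →
        ¬ IsBackwardSingularPoint w 0) :
    ForcedSymmetry ↔
      (∀ (u : ℝ → EuclideanSpace ℝ (Fin 3) → EuclideanSpace ℝ (Fin 3)) (p : ℝ → EuclideanSpace ℝ (Fin 3) → ℝ)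
        (G : ℝ → EuclideanSpace ℝ (Fin 3) → EuclideanSpace ℝ (Fin 3) →L[ℝ] EuclideanSpace ℝ (Fin 3)) (C : ℝ),
        IsSuitableWeakSolutionOn (slab (EuclideanSpace ℝ (Fin 3)) (Set.Iio 0) isOpen_Iio) 1 0 u p →
        HasWeakSpatialGradientOn (slab (EuclideanSpace ℝ (Fin 3)) (Set.Iio 0) isOpen_Iio) u G →
        typeIBound (Set.Iio (0 : ℝ) ×ˢ Set.univ) u p G < ⊤ →
        HasTypeITimeDecay C u →
        (∀ ε : ℝ, 0 < ε → ∀ K : Set (ℝ × EuclideanSpace ℝ (Fin 3)), IsCompact K → K ⊆ Set.Iic (0 : ℝ) ×ˢ Set.univ →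
          ∃ L : ℝ, 0 < L ∧ ∀ a : ℝ, ∃ σ ∈ Set.Icc a (a + L),
            eLpNorm (fun z : ℝ × EuclideanSpace ℝ (Fin 3) => nsRescale (Real.exp σ) u z.1 z.2 - u z.1 z.2) 3
              (volume.restrict K) ≤ ENNReal.ofReal ε) →
        IsBackwardSingularPoint u 0 →
        ∃ (w : ℝ → EuclideanSpace ℝ (Fin 3) → EuclideanSpace ℝ (Fin 3)) (q : ℝ → EuclideanSpace ℝ (Fin 3) → ℝ)
          (H : ℝ → EuclideanSpace ℝ (Fin 3) → EuclideanSpace ℝ (Fin 3) →L[ℝ] EuclideanSpace ℝ (Fin 3)) (C' : ℝ),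
          IsSuitableWeakSolutionOn (slab (EuclideanSpace ℝ (Fin 3)) (Set.Iio 0) isOpen_Iio) 1 0 w q ∧
          HasWeakSpatialGradientOn (slab (EuclideanSpace ℝ (Fin 3)) (Set.Iio 0) isOpen_Iio) w H ∧
          typeIBound (Set.Iio (0 : ℝ) ×ˢ Set.univ) w q H < ⊤ ∧
          HasTypeITimeDecay C' w ∧
          (∃ l : ℝ, 1 < l ∧ ∃ (R : EuclideanSpace ℝ (Fin 3) ≃ₗᵢ[ℝ] EuclideanSpace ℝ (Fin 3))
              (ξ : EuclideanSpace ℝ (Fin 3)) (τ : ℝ), τ ≤ 0 ∧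
              (fun z : ℝ × EuclideanSpace ℝ (Fin 3) => l • R.symm (w (l ^ 2 * z.1 + τ) (l • R z.2 + ξ)))
                =ᵐ[volume.restrict (Set.Iio (0 : ℝ) ×ˢ Set.univ)]
              (fun z : ℝ × EuclideanSpace ℝ (Fin 3) => w z.1 z.2)) ∧
          IsBackwardSingularPoint w 0) := by
  have h8561 : RDSSLiouvilleInClass := rdssLiouvilleInClass_of_birthStubs h3a h3c
  rw [recurrentClosingWeak_iff_rdssLiouville_imp, forcedSymmetry_iff_typeIAncientLiouville]
  exact ⟨fun hX _ => hX, fun h => h h8561⟩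

end Summit.NavierStokesRegularity.NavierStokesRegularity.Theorems.SymmetryModuliCountForcedSymmetry

end
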